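import Summits.ValiantsHypothesis.ValiantsHypothesis.Theorems.LacunarySymmetroidMatrixDescartesVSQPoints
import Summits.ValiantsHypothesis.ValiantsHypothesis.Theorems.MatrixDescartes.Negative.MatrixDescartesWitness24

/-!
# `MatrixDescartes` census — the ALL-`K` law of the `m = 2` row: `ζ_sym(2,K) ≥ 4K − 7` for every `K ≥ 4` (`vsq_law`)

HONEST FRAMING.  Val-V1-extremal engine seat val-v1x-eng-6 (g2), `--supports stmt-ValiantsHypothesis-18050`.  This file proves,
for EVERY `K ≥ 4`, `¬ PosRootLawAt 2 K (4K − 8)`: the explicit real symmetric `2 × 2` pencil `letters (K−2) (4K²)` of `…VSQDefs`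
has at least `4K − 7` distinct positive determinant zeros.  It supersedes the seat's per-`K` kernel rows
`Census.Reflect.vsq_not_posRootLawAt_2_K_(4K−8)` (`K = 9, …, 25`, files `…CensusM2VSQ{,2a,2b}`) by one theorem, and every
chain-ray law of the `m = 2` row (slope `≤ 11/3` per exponent) by slope `4` for all `K`.  A fixed-`m`, all-`K` LOWER bound says
nothing about the crux `MatrixDescartes` (stmt-18050: an UPPER bound `2^{C K log K}` in the window `m ≤ 2^{polylog K}`) either
way, and nothing about `VP ≠ VNP`.  Whether `ζ_sym(2,K) − 4K` is bounded is open (the Descartes ceiling `K(K+1)/2 − 1` is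
quadratic in `K`).

MECHANISM («Viro patchworking + square splitting»; design `…VSQDefs`/`…VSQDesign`, analysis `…VSQKit`, signs `…VSQPoints`).
Entries `±B^{h}`, `B = 4K²`, `t = B^x`, `n = K − 2`: on `x < 2n` the product `a·c` dominates `det = ac − b²` and the `a`-chain
alternates (`n + 1` signs at `x = −1, 1, …, 2n − 1`); on `2n < x < 4n + 2` the square `b²` dominates, `det < 0` at
`x = 2n + 1, 2n + 3, …, 4n − 1`, and between two consecutive such points `b` changes sign, so at ITS zero `t*` (`bz`, intermediate
value theorem) `det(t*) = a(t*) c(t*) > 0` — each sign change of `b` SPLITS into two determinant zeros, the non-transversal step a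
pure patchworking count cannot see; on `x > 4n + 2` the product `a_{n+1} t^{n²+5n} · c` dominates and the `c`-chain alternates
(`n + 2` signs at `x = 4n + 3, …, 6n + 5`).  `tau` lists the `4n + 2 = 4K − 6` points; `4K − 7` alternations
(`le_card_posRoots_of_alternating`, tree) give the count.
[folklore] Viro patchworking / dominance; intermediate value theorem.
-/

set_option linter.dupNamespace false
set_option autoImplicit false

namespace Summit.ValiantsHypothesis.ValiantsHypothesis.Theorems.LacunarySymmetroidMatrixDescartes.VSQ

open scoped BigOperators
open Finset Polynomial
open Summit.ValiantsHypothesis.ValiantsHypothesis.Theorems.MatrixDescartes.Negative (PosRootLawAt)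
open Summit.ValiantsHypothesis.ValiantsHypothesis.Theorems.SymmetroidDescartes (le_card_posRoots_of_alternating)

variable {n : ℕ} {B : ℝ}

/-! ## 1. The `4K − 6` points and the count -/

/-- `(−1)^{n+j} · det > 0` at the `j`-th point. [folklore] -/
theorem sign_tau (hn : 2 ≤ n) (hB : 4 * ((n + 2 : ℕ) : ℝ) ^ 2 ≤ B) (j : ℕ) (hj : j ≤ 4 * n + 1) :
    0 < (-1 : ℝ) ^ (n + j) * D n B (tau n B j) := by
  unfold tau
  by_cases hj1 : j ≤ n + 1
  · rw [if_pos hj1]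
    rcases Nat.eq_zero_or_pos j with h0 | hj0
    · subst h0; simpa using sign_low hn hB
    · by_cases hjn : j ≤ n
      · exact sign_blkA hn hB hj0 hjn
      · have hj' : j = n + 1 := by omega
        subst hj'
        have h := sign_W hn hB (w := 1) le_rfl (by omega)
        have e : (-1 : ℝ) ^ (n + (n + 1)) = -1 := by
          rw [show n + (n + 1) = 2 * n + 1 by ring, pow_add, pow_mul]; norm_num
        rw [e, show (2 * ((n + 1 : ℕ) : ℤ) - 1) = 2 * (n : ℤ) + 2 * (1 : ℕ) - 1 by push_cast; ring]
        linarith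
  · rw [if_neg hj1]
    by_cases hj2 : j ≤ 3 * n - 1
    · rw [if_pos hj2]
      by_cases hpar : (j - n) % 2 = 0
      · rw [if_pos hpar]
        obtain ⟨w, hw⟩ : ∃ w, j = n + 2 * w := ⟨(j - n) / 2, by omega⟩
        have hw' : (j - n) / 2 = w := by omega
        rw [hw']
        have e : (-1 : ℝ) ^ (n + j) = 1 := by rw [hw, show n + (n + 2 * w) = 2 * (n + w) by ring, pow_mul]; norm_num
        rw [e, one_mul]
        exact sign_bz hn hB (by omega) (by omega)
      · rw [if_neg hpar]
        obtain ⟨w, hw⟩ : ∃ w, j = n + 2 * w - 1 ∧ 2 ≤ w := ⟨(j - n + 1) / 2, by omega, by omega⟩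
        have e : (-1 : ℝ) ^ (n + j) = -1 := by
          rw [show n + j = 2 * (n + w - 1) + 1 by omega, pow_add, pow_mul]; norm_num
        have e2 : ((j : ℤ) + n) = 2 * (n : ℤ) + 2 * w - 1 := by
          have : (j : ℤ) = n + 2 * w - 1 := by omega
          linarith
        rw [e, e2]
        linarith [sign_W hn hB (w := w) (by omega) (by omega)]
    · rw [if_neg hj2]
      by_cases hj3 : j = 3 * n
      · subst hj3
        have e : (-1 : ℝ) ^ (n + 3 * n) = 1 := by rw [show n + 3 * n = 2 * (2 * n) by ring, pow_mul]; norm_num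
        rw [e, one_mul, show (2 * ((3 * n : ℕ) : ℤ) - 2 * n + 3) = 4 * (n : ℤ) + 3 by push_cast; ring]
        exact sign_mid hn hB
      · by_cases hj4 : j ≤ 4 * n
        · obtain ⟨w, hw⟩ : ∃ w, j = 3 * n + w := ⟨j - 3 * n, by omega⟩
          subst hw
          have e : (-1 : ℝ) ^ (n + (3 * n + w)) = (-1) ^ w := by
            rw [show n + (3 * n + w) = 2 * (2 * n) + w by ring, pow_add, pow_mul]; norm_num
          rw [e, show (2 * ((3 * n + w : ℕ) : ℤ) - 2 * n + 3) = 4 * (n : ℤ) + 2 * w + 3 by push_cast; ring]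
          exact sign_blkC hn hB (by omega) (by omega)
        · have hj5 : j = 4 * n + 1 := by omega
          subst hj5
          have e : (-1 : ℝ) ^ (n + (4 * n + 1)) = (-1) ^ (n + 1) := by
            rw [show n + (4 * n + 1) = 2 * (2 * n) + (n + 1) by ring, pow_add, pow_mul]; norm_num
          rw [e, show (2 * ((4 * n + 1 : ℕ) : ℤ) - 2 * n + 3) = 6 * (n : ℤ) + 5 by push_cast; ring]
          exact sign_top hn hB

/-- the points increase. [folklore] -/
theorem tau_lt_succ (hn : 2 ≤ n) (hB : 4 * ((n + 2 : ℕ) : ℝ) ^ 2 ≤ B) (j : ℕ) (hj : j + 1 ≤ 4 * n + 1) :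
    tau n B j < tau n B (j + 1) := by
  obtain ⟨hB1, -⟩ := hB_basic hB
  unfold tau
  by_cases hj1 : j + 1 ≤ n + 1
  · rw [if_pos (by omega : j ≤ n + 1), if_pos hj1]
    exact zpow_lt_zpow_right₀ hB1 (by push_cast; linarith)
  · rw [if_neg hj1]
    by_cases hj1' : j ≤ n + 1
    · -- j = n + 1
      have hj : j = n + 1 := by omega
      subst hj
      rw [if_pos le_rfl, if_pos (by omega), if_pos (by omega), show (n + 1 + 1 - n) / 2 = 1 by omega]
      have h := (bz_spec hB (w := 1) le_rfl (by omega)).1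
      rw [show (2 * ((n + 1 : ℕ) : ℤ) - 1) = 2 * (n : ℤ) + 2 * (1 : ℕ) - 1 by push_cast; ring]
      exact h
    · rw [if_neg hj1']
      by_cases hj2 : j + 1 ≤ 3 * n - 1
      · rw [if_pos (by omega : j ≤ 3 * n - 1), if_pos hj2]
        by_cases hpar : (j - n) % 2 = 0
        · obtain ⟨w, hw⟩ : ∃ w, j = n + 2 * w := ⟨(j - n) / 2, by omega⟩
          rw [if_pos hpar, if_neg (by omega), show (j - n) / 2 = w by omega]
          have h := (bz_spec hB (w := w) (by omega) (by omega)).2.1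
          rw [show ((j + 1 : ℕ) : ℤ) + n = 2 * (n : ℤ) + 2 * (w + 1 : ℕ) - 1 by push_cast; omega]
          exact h
        · obtain ⟨w, hw⟩ : ∃ w, j + 1 = n + 2 * w := ⟨(j + 1 - n) / 2, by omega⟩
          rw [if_neg hpar, if_pos (by omega), show (j + 1 - n) / 2 = w by omega]
          have h := (bz_spec hB (w := w) (by omega) (by omega)).1
          rw [show (j : ℤ) + n = 2 * (n : ℤ) + 2 * w - 1 by omega]
          exact h
      · rw [if_neg hj2]
        by_cases hj2' : j ≤ 3 * n - 1
        · -- j = 3n - 1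
          rw [if_pos hj2', if_neg (by omega)]
          exact zpow_lt_zpow_right₀ hB1 (by push_cast; omega)
        · rw [if_neg hj2']
          exact zpow_lt_zpow_right₀ hB1 (by push_cast; linarith)

/-- the points are positive. [folklore] -/
theorem tau_pos (hn : 2 ≤ n) (hB : 4 * ((n + 2 : ℕ) : ℝ) ^ 2 ≤ B) (j : ℕ) : 0 < tau n B j := by
  obtain ⟨hB1, -⟩ := hB_basic hB
  have hB0 : 0 < B := lt_trans zero_lt_one hB1
  unfold tau
  split_ifs with h1 h2 h3
  · exact zpow_pos hB0 _
  · obtain ⟨w, hw⟩ : ∃ w, j = n + 2 * w := ⟨(j - n) / 2, by omega⟩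
    rw [show (j - n) / 2 = w by omega]
    exact lt_trans (zpow_pos hB0 _) (bz_spec hB (w := w) (by omega) (by omega)).1
  · exact zpow_pos hB0 _
  · exact zpow_pos hB0 _

/-- **`4n + 1 = 4K − 7` distinct positive zeros** for the family (`K = n + 2`, `n ≥ 2`, `B ≥ 4K²`). [folklore] -/
theorem card_posRoots_ge (hn : 2 ≤ n) (hB : 4 * ((n + 2 : ℕ) : ℝ) ^ 2 ≤ B) :
    4 * n + 1 ≤ ((∑ l, (X : ℝ[X]) ^ dF n l • (letters n B l).map Polynomial.C).det.roots.toFinset.filter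
      (fun t => 0 < t)).card := by
  refine le_card_posRoots_of_alternating _ (4 * n + 1) (fun j => tau n B j)
    (Fin.strictMono_iff_lt_succ.2 fun i => ?_) (fun j => tau_pos hn hB j) fun j => ?_
  · simpa using tau_lt_succ hn hB i (by have := i.isLt; omega)
  · have hj : (j : ℕ) + 1 ≤ 4 * n + 1 := by have := j.isLt; omega
    have h1 := sign_tau hn hB j (by omega)
    have h2 := sign_tau hn hB (j + 1) hj
    rw [eval_det_letters, eval_det_letters]
    simp only [Fin.val_castSucc, Fin.val_succ]
    have e : (-1 : ℝ) ^ (n + (j + 1)) = -(-1 : ℝ) ^ (n + j) := by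
      rw [show n + (j + 1) = (n + j) + 1 by ring, pow_succ]; ring
    rw [e] at h2
    have hsq : (-1 : ℝ) ^ (n + j) * (-1 : ℝ) ^ (n + j) = 1 := by
      rw [← pow_add, ← two_mul, pow_mul]; norm_num
    nlinarith [mul_pos h1 h2]

/-! ## 2. The law -/

/-- **`ζ_sym(2,K) ≥ 4K − 7` for every `K ≥ 4`**: the row `PosRootLawAt 2 K (4K − 8)` («every real symmetric `2 × 2` pencil with
`K` exponents has at most `4K − 8` distinct positive determinant zeros») is FALSE for every `K ≥ 4`. [folklore] -/
theorem vsq_law (K : ℕ) (hK : 4 ≤ K) : ¬ PosRootLawAt 2 K (4 * K - 8) := by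
  obtain ⟨n, rfl⟩ : ∃ n, K = n + 2 := ⟨K - 2, by omega⟩
  have hn : 2 ≤ n := by omega
  intro h
  have h1 := h (dF n) (letters n (4 * ((n + 2 : ℕ) : ℝ) ^ 2)) (letters_isSymm n _)
  have h2 := card_posRoots_ge (B := 4 * ((n + 2 : ℕ) : ℝ) ^ 2) hn le_rfl
  omega

/-- the same in witness form: for every `K ≥ 4` an explicit symmetric `2 × 2` pencil with `K` exponents and at least `4K − 7`
distinct positive determinant zeros. [folklore] -/
theorem exists_pencil_two (K : ℕ) (hK : 4 ≤ K) :
    ∃ (d : Fin K → ℕ) (S : Fin K → Matrix (Fin 2) (Fin 2) ℝ), (∀ l, (S l).IsSymm) ∧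
      4 * K - 7 ≤ ((∑ l, (X : ℝ[X]) ^ d l • (S l).map Polynomial.C).det.roots.toFinset.filter
        (fun t => 0 < t)).card := by
  obtain ⟨n, rfl⟩ : ∃ n, K = n + 2 := ⟨K - 2, by omega⟩
  refine ⟨dF n, letters n (4 * ((n + 2 : ℕ) : ℝ) ^ 2), letters_isSymm n _, ?_⟩
  have h2 := card_posRoots_ge (B := 4 * ((n + 2 : ℕ) : ℝ) ^ 2) (by omega) le_rfl
  omega

end Summit.ValiantsHypothesis.ValiantsHypothesis.Theorems.LacunarySymmetroidMatrixDescartes.VSQ
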